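import Literature.MathematicalPhysics.QuantumFieldTheory.Balaban1983to89.B9Thm33GreenL2BoundCubeZd

/-!
# `Balaban1983to89.B9Eq386ResolventBoundZd` — [Balaban1985BackgroundPropagators] (3.84)–(3.86) p. 407 and the proof of Thm 3.11 p. 416 («G_□(e^{iηA}) =
# G_□(1)(I − V(A)G_□(1))⁻¹») AT THE `ℤᵈ × 𝔸` CARRIER: THE SECOND RESOLVENT IDENTITY `G_𝔤(U) − G_𝔤(V) = G_𝔤(U)(Δ_a(V) − Δ_a(U))G_𝔤(V)` ON `E_𝔤(□₀)` FOR THE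
# GENUINE PROPAGATORS AT TWO BACKGROUNDS, AND THE COMPARISON BOUND `‖G_𝔤(U)J − G_𝔤(V)J‖_τ ≤ c⁻¹‖herm 𝟙_{Ω₀}(Δ_a(V) − Δ_a(U))G_𝔤(V)J‖_τ` WITH ONE CONSTANT
# FOR EVERY PAIR OF SMALL FIELDS NEAR THE MEMBER — in particular the curved propagator against the flat one

statement-level skeleton of published theorems with citation tags; proofs where landed; nothing here is a claim about the
Yang–Mills mass gap

`[Balaban1985BackgroundPropagators]` ("B9", CMP **99** (1985) 389–434) p. 407: *«Δ_a(U′U) = Δ_a(U) − V(A) = (I − V(A)G(U))Δ_a(U). (3.84) … G(U′U) =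
G(U)(I − V(A)G(U))⁻¹ = Σ_{n=0}^∞ G(U)(V(A)G(U))ⁿ, (3.86) and convergence is in the operator norm for α₁ sufficiently small»*; p. 416 (proof of Thm 3.11):
*«Doing the gauge transformation we get the configuration U = e^{iηA} with A small, and by (3.86) we get G_□(e^{iηA}) = G_□(1)(I − V(A)G_□(1))⁻¹»*.  The
algebraic core of (3.84)∕(3.86) is the second resolvent identity; its FIRST-ORDER consequence with a coercivity constant is the comparison bound of this file
(the Neumann series (3.86) is its iteration under the smallness `|V(A)G(U)| ≤ O(1)α₁` of (3.85), NOT proved here).  PDF held: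
`paper:balaban1985-cmp99-background-propagators` pp. 407, 416 (re-read by this seat, 2026-08-28: `lit read … --grep '3.86'`, p0019 L24, p0028 L31).

CITATION HEADER (lean-in-tree rule).  Cell `pub-ymgap` (YM Track A, HUMAN RULING D-0062 ∕ D-0149 width push), DAG node N06 = [B9], width seat
`pub-ymgap-dag-n06-w4` (g4), CLAIM-4 ∕ INTENT-4.  Inputs BY NAME: this seat's g4 `B9Thm33GreenL2BoundCubeZd` (`bondPair_gopZdH_self_le_of_coercive`, `deltaADom_gopZdH`,
`exists_L2Bound…`'s inputs), g4 `B9Thm311CoerciveCompactZd.exists_coercive_and_regularAtH_of_pdevOn_lt_cube`, dag-n06-b `B9Eq327GreenZdHerm` (`gopZdH`,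
`gopZdH_apply_eq_of_regularAtH`), `B9Eq316AveragingTransposeZdLevelZero.linearOnDomAt_opsAllZd_cubeLamBP` (ℝ-linearity of the genuine `Δ_a` at every unitary
background, print's class), g2 `B9Eq327GreenZd`.

WHAT IS PROVED (kernel, 0 sorry; theorems only — no `def`, `instance`, `notation`).
* §1 (ANY record `o`, finite or infinite `Ω₀`) `deltaAOf_sub_of_linearOnDomAt` (`Δ_a(U)(A − B) = Δ_a(U)A − Δ_a(U)B` on `E(Ω₀)`), ★★ `gopZdH_sub_eq` — THE SECOND
  RESOLVENT IDENTITY ON `E_𝔤(Ω₀)`: `RegularAtH` at `U` and at `V`, `Δ_a(U)` ℝ-linear on `E(Ω₀)` ⟹ `G_𝔤(U)J − G_𝔤(V)J = G_𝔤(U)[Δ_a(V)(G_𝔤(V)J) − Δ_a(U)(G_𝔤(V)J)]`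
  for EVERY bond field `J` ((3.84)∕(3.86) to first order).
* §2 (finite `Ω₀`, faithful Hermitian `τ`) ★★ `bondPair_gopZdH_sub_self_le` — + `c`-coercivity at `U` ⟹
  `⟨G_𝔤(U)J − G_𝔤(V)J, G_𝔤(U)J − G_𝔤(V)J⟩_τ ≤ c⁻²·⟨W̃, W̃⟩_τ`, `W̃ = herm 𝟙_{Ω₀}(Δ_a(V) − Δ_a(U))(G_𝔤(V)J)`.
* §3 (cube members, the genuine four-letter `Δ_a` of `opsAllZd` at print's class `cubeLamBP`) ★★★★ `exists_resolventBound_of_pdevOn_lt_cube` — THERE ARE `α > 0` AND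
  `c > 0` (member-dependent) such that for EVERY PAIR of unitary backgrounds `U₀, V₀` with plaquettes `α`-close to `1` on `□₀ ± 3` and every bond field `J`:
  the identity of §1 holds and `‖G_𝔤(U₀)J − G_𝔤(V₀)J‖²_τ ≤ c⁻²·‖herm 𝟙_{□₀}(Δ_a(V₀) − Δ_a(U₀))G_𝔤(V₀)J‖²_τ`; ★★★ `exists_resolventBound_one_of_pdevOn_lt_cube`
  (`V₀ = 1`: THE CURVED PROPAGATOR AGAINST THE FLAT ONE — `G_𝔤(U₀)J − G_𝔤(1)J` is controlled by the perturbation `Δ_a(1) − Δ_a(U₀)` = print's `V` acting on the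
  flat solution `G_𝔤(1)J`, with ONE constant for the whole local small-field class).

HONEST SCOPE.  (i) FIRST ORDER ONLY: the identity and the one-step bound; the Neumann series (3.86) and its convergence (smallness (3.85) of `V(A)G(U)`) are
NOT proved — no estimate of `Δ_a(V) − Δ_a(U)` in terms of `V⁻¹U` is made here (that is the content of (3.73), (3.77), (3.83)).  (ii) `L²_τ` currency only; no
sup-norm ∕ decay ∕ derivative statements.  (iii) `α, c` MEMBER-DEPENDENT, NON-QUANTITATIVE (compactness).  (iv) `τ` is a PARAMETER; no instance.  (v) A6: at
`U₀ = V₀ (= 1)` both sides vanish — the identity is inhabited non-trivially by every pair in the class (n06-w2 g3's `expCfg_iEta_mem_reg17Univ` backgrounds, e.g.).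
(vi) Count-neutral helper (`--supports` the K1 item of record); N05 ∕ N06 NOT discharged; K1 NOT closed; one finite `𝕋⁴` programme at fixed `ε`, Bałaban as
printed; R4 closes only the conditional finite-`𝕋⁴` rung `BalabanLadder.UV` — nothing continuum ∕ ℝ⁴ ∕ OS ∕ mass gap ∕ Clay.  Unit `pub-ymgap-dag-n06-w4` (g4), 2026-08-28.
-/

noncomputable section

namespace Literature.MathematicalPhysics.QuantumFieldTheory.Balaban1983to89.B9Eq386ResolventBoundZd

open Filter Topology
open B7Prop1Explicit
open B7Prop1Local (pdevOn)
open B7Prop2Explicit (unitaryUnits)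
open B8Ineq132 (BondTouches)
open B8Eq131Cubes (sqLo sqHi)
open B8Eq131CubesAdmissible (cubeFam)
open B8CubeMemberZd (cubeLamS)
open B8Ineq159FlatCubeMemberPrinted (cubeLamBP)
open B8LeafModelZd (ZdIdx)
open B9SupplySockB9P3ZdLetters (OpsZd deltaAOf)
open B9SupplySockB9P3ZdLettersOmega (restrictDom restrictDom_of)
open B9SupplySockB9P3ZdAllLettersZd (opsAllZd)
open B9Eq316AveragingTransposeZdLevelZero (linearOnDomAt_opsAllZd_cubeLamBP)
open B9Eq327GreenZd (domSub bondPair deltaADom LinearOnDomAt)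
open B9Eq327GreenZdHerm (domSubH domSubH_le RegularAtH gopZdH gopZdH_mem_domSubH gopZdH_apply_eq_of_regularAtH restrictLinH)
open B9Thm311PosDefOpenZd (cubeMember_Ω0_finite)
open B9Thm311CoerciveCompactZd (exists_coercive_and_regularAtH_of_pdevOn_lt_cube pdevOn_one)
open B9Thm33GreenL2BoundCubeZd (deltaADom_gopZdH bondPair_gopZdH_self_le_of_coercive)

-- `Site` alone could resolve to the torus sites of `Setup.lean`; re-export the `ℤ^d` sites of `B7Prop1Explicit`.
export B7Prop1Explicit (Site)

variable {d : ℕ} {𝔸 : Type*} [CStarAlgebra 𝔸]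

/-! ## §1  The second resolvent identity on `E_𝔤(Ω₀)` -/

section Identity

variable (η : ℝ) (o : OpsZd d 𝔸) (Ω₀ : Set (Site d))

/-- `Δ_a(U)` is additive on `E(Ω₀)` when it agrees there with an ℝ-linear map: `Δ_a(U)(A − B) = Δ_a(U)A − Δ_a(U)B`.
[cite: Balaban1985BackgroundPropagators, (3.26) p.395 («Δ_a» is a linear operator)] -/
theorem deltaAOf_sub_of_linearOnDomAt {U : Site d → Fin d → 𝔸ˣ} (hlin : LinearOnDomAt η o Ω₀ U) {A B : Site d → Fin d → 𝔸}
    (hA : A ∈ domSub (𝔸 := 𝔸) Ω₀) (hB : B ∈ domSub (𝔸 := 𝔸) Ω₀) : deltaAOf η o U (A - B) = deltaAOf η o U A - deltaAOf η o U B := by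
  obtain ⟨T, hT⟩ := hlin
  rw [← hT A hA, ← hT B hB, ← hT (A - B) (Submodule.sub_mem _ hA hB), map_sub]

/-- ★★ **THE SECOND RESOLVENT IDENTITY FOR THE GENUINE PROPAGATORS AT TWO BACKGROUNDS** ((3.84)∕(3.86) to first order): if `Δ_a↾Ω₀` is invertible on `E_𝔤(Ω₀)` at
`U` and at `V` (`RegularAtH`) and `Δ_a(U)` is ℝ-linear on `E(Ω₀)`, then for EVERY bond field `J`
`G_𝔤(U)J − G_𝔤(V)J = G_𝔤(U)[Δ_a(V)(G_𝔤(V)J) − Δ_a(U)(G_𝔤(V)J)]` — both `Δ_a(U)(G_𝔤(U)J)` and `Δ_a(V)(G_𝔤(V)J)` equal `herm 𝟙_{Ω₀}J` on the bonds of `Ω₀`.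
[cite: Balaban1985BackgroundPropagators, (3.84)–(3.86) p.407, Thm 3.11 p.416 (proof), (3.27) p.395] -/
theorem gopZdH_sub_eq {U V : Site d → Fin d → 𝔸ˣ} (hU : RegularAtH η o Ω₀ U) (hV : RegularAtH η o Ω₀ V) (hlin : LinearOnDomAt η o Ω₀ U)
    (J : Site d → Fin d → 𝔸) :
    gopZdH η o Ω₀ U J - gopZdH η o Ω₀ V J =
      gopZdH η o Ω₀ U (deltaAOf η o V (gopZdH η o Ω₀ V J) - deltaAOf η o U (gopZdH η o Ω₀ V J)) := by
  set A : Site d → Fin d → 𝔸 := gopZdH η o Ω₀ U J with hAdef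
  set B : Site d → Fin d → 𝔸 := gopZdH η o Ω₀ V J with hBdef
  have hA : A ∈ domSubH (𝔸 := 𝔸) Ω₀ := gopZdH_mem_domSubH η o Ω₀ U J
  have hB : B ∈ domSubH (𝔸 := 𝔸) Ω₀ := gopZdH_mem_domSubH η o Ω₀ V J
  have hD : A - B ∈ domSubH (𝔸 := 𝔸) Ω₀ := Submodule.sub_mem _ hA hB
  -- `Δ_a(U)A = herm 𝟙J = Δ_a(V)B` on the bonds of `Ω₀`
  have hUA : ∀ (y : Site d) (τ : Fin d), BondTouches Ω₀ y τ → deltaAOf η o U A y τ = (restrictLinH (𝔸 := 𝔸) Ω₀ J : Site d → Fin d → 𝔸) y τ := by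
    intro y τ hb
    have h := congr_fun (congr_fun (deltaADom_gopZdH η o Ω₀ U hU J) y) τ
    rw [deltaADom, restrictDom_of _ hb] at h
    exact h
  have hVB : ∀ (y : Site d) (τ : Fin d), BondTouches Ω₀ y τ → deltaAOf η o V B y τ = (restrictLinH (𝔸 := 𝔸) Ω₀ J : Site d → Fin d → 𝔸) y τ := by
    intro y τ hb
    have h := congr_fun (congr_fun (deltaADom_gopZdH η o Ω₀ V hV J) y) τ
    rw [deltaADom, restrictDom_of _ hb] at h
    exact h
  symm
  refine gopZdH_apply_eq_of_regularAtH η o Ω₀ U hU hD fun y τ hb => ?_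
  rw [deltaAOf_sub_of_linearOnDomAt η o Ω₀ hlin (domSubH_le Ω₀ hA) (domSubH_le Ω₀ hB), Pi.sub_apply, Pi.sub_apply, Pi.sub_apply, Pi.sub_apply,
    hUA y τ hb, hVB y τ hb]

end Identity

/-! ## §2  The comparison bound from a coercivity constant -/

section Bound

variable (τ : 𝔸 →ₗ[ℂ] ℂ) (hτp : ∀ a : 𝔸, a ≠ 0 → 0 < (τ (star a * a)).re) (hτs : ∀ a : 𝔸, τ (star a) = starRingEnd ℂ (τ a))
variable (η : ℝ) (o : OpsZd d 𝔸) (Ω₀ : Set (Site d))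

include hτp hτs in
/-- ★★ **THE COMPARISON BOUND AT TWO BACKGROUNDS**: `RegularAtH` at `U`, `V`, `Δ_a(U)` ℝ-linear on `E(Ω₀)` (finite `Ω₀`) and `c`-coercive on `E_𝔤(Ω₀)` ⟹
`⟨G_𝔤(U)J − G_𝔤(V)J, G_𝔤(U)J − G_𝔤(V)J⟩_τ ≤ c⁻²·⟨W̃, W̃⟩_τ` with `W̃ = herm 𝟙_{Ω₀}(Δ_a(V)(G_𝔤(V)J) − Δ_a(U)(G_𝔤(V)J))` — §1 + this seat's `L²_τ` bound
`‖G_𝔤(U)‖ ≤ c⁻¹`. [cite: Balaban1985BackgroundPropagators, (3.84)–(3.86) p.407, Thm 3.3 p.399; Balaban1984PropagatorsII, p.226, (2.22)] -/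
theorem bondPair_gopZdH_sub_self_le (hΩ : Ω₀.Finite) {U V : Site d → Fin d → 𝔸ˣ} (hU : RegularAtH η o Ω₀ U) (hV : RegularAtH η o Ω₀ V)
    (hlin : LinearOnDomAt η o Ω₀ U) {c : ℝ} (hc : 0 < c)
    (hcoer : ∀ A ∈ domSubH (𝔸 := 𝔸) Ω₀, c * bondPair τ A A ≤ bondPair τ A (deltaAOf η o U A)) (J : Site d → Fin d → 𝔸) :
    bondPair τ (gopZdH η o Ω₀ U J - gopZdH η o Ω₀ V J) (gopZdH η o Ω₀ U J - gopZdH η o Ω₀ V J) ≤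
      c⁻¹ ^ 2 * bondPair τ
        (restrictLinH (𝔸 := 𝔸) Ω₀ (deltaAOf η o V (gopZdH η o Ω₀ V J) - deltaAOf η o U (gopZdH η o Ω₀ V J)) : Site d → Fin d → 𝔸)
        (restrictLinH (𝔸 := 𝔸) Ω₀ (deltaAOf η o V (gopZdH η o Ω₀ V J) - deltaAOf η o U (gopZdH η o Ω₀ V J)) : Site d → Fin d → 𝔸) := by
  rw [gopZdH_sub_eq η o Ω₀ hU hV hlin J]
  exact bondPair_gopZdH_self_le_of_coercive τ hτp hτs η o Ω₀ U hΩ hU hc hcoer _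

end Bound

/-! ## §3  Cube members: the comparison bound with ONE constant for every pair of small fields near the member -/

section Cube

variable [FiniteDimensional ℝ 𝔸] [Nontrivial 𝔸] {L : ℕ}
variable (τ : 𝔸 →ₗ[ℂ] ℂ) (hτp : ∀ a : 𝔸, a ≠ 0 → 0 < (τ (star a * a)).re)
  (hτt : ∀ a b : 𝔸, τ (a * b) = τ (b * a)) (hτs : ∀ a : 𝔸, τ (star a) = starRingEnd ℂ (τ a))

include hτp hτt hτs in
/-- ★★★★ **(3.84)∕(3.86) TO FIRST ORDER FOR THE GENUINE PROPAGATORS AT ONE CUBE MEMBER, WITH ONE CONSTANT**: at a cube member of [Balaban1985RegularSpaces] (1.131)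
(`Ω = cubeFam false L a Mc ρ k`, `Λs = cubeLamS …`, `m ≤ k`, `2 ≤ d`, `2 ≤ L ≤ ρ`), print's class `cubeLamBP`, faithful Hermitian tracial `τ` on a finite-dimensional
fibre: THERE ARE `α > 0` AND `c > 0` such that for EVERY PAIR of unitary backgrounds `U₀, V₀` whose plaquettes are `α`-close to `1` on `□₀ ± 3` and every bond field
`J`: (a) `G_𝔤(U₀)J − G_𝔤(V₀)J = G_𝔤(U₀)[Δ_a(V₀)(G_𝔤(V₀)J) − Δ_a(U₀)(G_𝔤(V₀)J)]`; (b) `⟨G_𝔤(U₀)J − G_𝔤(V₀)J, ·⟩_τ ≤ c⁻²·⟨W̃, W̃⟩_τ`,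
`W̃ = herm 𝟙_{□₀}(Δ_a(V₀) − Δ_a(U₀))(G_𝔤(V₀)J)` — `G_𝔤 = gopZdH` of the genuine four-letter `Δ_a` of `opsAllZd`.
[cite: Balaban1985BackgroundPropagators, (3.84)–(3.86) p.407, Thm 3.11 p.416, (3.27) p.395; Balaban1984PropagatorsII, (2.22) p.226; Balaban1985RegularSpaces, (1.7) p.77, (1.131) p.99] -/
theorem exists_resolventBound_of_pdevOn_lt_cube (hd2 : 2 ≤ d) (hL : 2 ≤ L) (ops₀ : ℝ → ZdIdx d L → ℕ → OpsZd d 𝔸) (M : ℝ) (i : ZdIdx d L)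
    {a : Site d} {Mc ρ : ℕ} (hρ : L ≤ ρ) (hΩ : i.Ω = cubeFam false L a Mc ρ i.k) (hΛs : i.Λs = cubeLamS L a Mc ρ i.k) {m : ℕ} (hm : m ≤ i.k) :
    ∃ α : ℝ, 0 < α ∧ ∃ c : ℝ, 0 < c ∧ ∀ U₀ V₀ : Site d → Fin d → 𝔸ˣ, (∀ x κ, U₀ x κ ∈ unitaryUnits 𝔸) → (∀ x κ, V₀ x κ ∈ unitaryUnits 𝔸) →
      pdevOn (fun i' => sqLo L a ρ i.k 0 i' - 3) (fun i' => sqHi L a Mc ρ i.k 0 i' + 3) U₀ < α →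
      pdevOn (fun i' => sqLo L a ρ i.k 0 i' - 3) (fun i' => sqHi L a Mc ρ i.k 0 i' + 3) V₀ < α →
        ∀ J : Site d → Fin d → 𝔸,
          (gopZdH i.η (opsAllZd τ L (cubeLamBP L a Mc ρ i.k) ops₀ M i m) (i.Ω 0) U₀ J -
              gopZdH i.η (opsAllZd τ L (cubeLamBP L a Mc ρ i.k) ops₀ M i m) (i.Ω 0) V₀ J =
            gopZdH i.η (opsAllZd τ L (cubeLamBP L a Mc ρ i.k) ops₀ M i m) (i.Ω 0) U₀
              (deltaAOf i.η (opsAllZd τ L (cubeLamBP L a Mc ρ i.k) ops₀ M i m) V₀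
                  (gopZdH i.η (opsAllZd τ L (cubeLamBP L a Mc ρ i.k) ops₀ M i m) (i.Ω 0) V₀ J) -
                deltaAOf i.η (opsAllZd τ L (cubeLamBP L a Mc ρ i.k) ops₀ M i m) U₀
                  (gopZdH i.η (opsAllZd τ L (cubeLamBP L a Mc ρ i.k) ops₀ M i m) (i.Ω 0) V₀ J))) ∧
          bondPair τ
              (gopZdH i.η (opsAllZd τ L (cubeLamBP L a Mc ρ i.k) ops₀ M i m) (i.Ω 0) U₀ J -
                gopZdH i.η (opsAllZd τ L (cubeLamBP L a Mc ρ i.k) ops₀ M i m) (i.Ω 0) V₀ J)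
              (gopZdH i.η (opsAllZd τ L (cubeLamBP L a Mc ρ i.k) ops₀ M i m) (i.Ω 0) U₀ J -
                gopZdH i.η (opsAllZd τ L (cubeLamBP L a Mc ρ i.k) ops₀ M i m) (i.Ω 0) V₀ J) ≤
            c⁻¹ ^ 2 * bondPair τ
              (restrictLinH (𝔸 := 𝔸) (i.Ω 0)
                (deltaAOf i.η (opsAllZd τ L (cubeLamBP L a Mc ρ i.k) ops₀ M i m) V₀
                    (gopZdH i.η (opsAllZd τ L (cubeLamBP L a Mc ρ i.k) ops₀ M i m) (i.Ω 0) V₀ J) -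
                  deltaAOf i.η (opsAllZd τ L (cubeLamBP L a Mc ρ i.k) ops₀ M i m) U₀
                    (gopZdH i.η (opsAllZd τ L (cubeLamBP L a Mc ρ i.k) ops₀ M i m) (i.Ω 0) V₀ J)) : Site d → Fin d → 𝔸)
              (restrictLinH (𝔸 := 𝔸) (i.Ω 0)
                (deltaAOf i.η (opsAllZd τ L (cubeLamBP L a Mc ρ i.k) ops₀ M i m) V₀
                    (gopZdH i.η (opsAllZd τ L (cubeLamBP L a Mc ρ i.k) ops₀ M i m) (i.Ω 0) V₀ J) -
                  deltaAOf i.η (opsAllZd τ L (cubeLamBP L a Mc ρ i.k) ops₀ M i m) U₀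
                    (gopZdH i.η (opsAllZd τ L (cubeLamBP L a Mc ρ i.k) ops₀ M i m) (i.Ω 0) V₀ J)) : Site d → Fin d → 𝔸) := by
  have hfin : (i.Ω 0).Finite := cubeMember_Ω0_finite i hΩ
  obtain ⟨α, hα, c, hc, h⟩ := exists_coercive_and_regularAtH_of_pdevOn_lt_cube τ hτp hτt hτs hd2 hL ops₀ M i hρ hΩ hΛs hm
  refine ⟨α, hα, c, hc, fun U₀ V₀ hU₀ hV₀ hsU hsV J => ?_⟩
  obtain ⟨hcoer, hregU, -⟩ := h U₀ hU₀ hsU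
  obtain ⟨-, hregV, -⟩ := h V₀ hV₀ hsV
  have hlin := linearOnDomAt_opsAllZd_cubeLamBP τ hL ops₀ M i hρ hΩ hfin hm hU₀
  exact ⟨gopZdH_sub_eq i.η _ (i.Ω 0) hregU hregV hlin J,
    bondPair_gopZdH_sub_self_le τ hτp hτs i.η _ (i.Ω 0) hfin hregU hregV hlin hc hcoer J⟩

include hτp hτt hτs in
/-- ★★★ **THE CURVED PROPAGATOR AGAINST THE FLAT ONE** (print's use of (3.86) in the proof of Thm 3.11, to first order): `α > 0`, `c > 0` (member-dependent)
with, for every unitary `U₀` `α`-small on `□₀ ± 3` and every bond field `J`: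
`⟨G_𝔤(U₀)J − G_𝔤(1)J, G_𝔤(U₀)J − G_𝔤(1)J⟩_τ ≤ c⁻²·⟨W̃, W̃⟩_τ`, `W̃ = herm 𝟙_{□₀}(Δ_a(1) − Δ_a(U₀))(G_𝔤(1)J)` — the deviation of the curved propagator
from the flat one is at most `c⁻¹` times the action of print's perturbation `V = Δ_a(U₀) − Δ_a(1)` on the FLAT solution.
[cite: Balaban1985BackgroundPropagators, Thm 3.11 p.416 (proof), (3.84)–(3.86) p.407; Balaban1984PropagatorsII, (2.11) p.225, (2.22) p.226] -/
theorem exists_resolventBound_one_of_pdevOn_lt_cube (hd2 : 2 ≤ d) (hL : 2 ≤ L) (ops₀ : ℝ → ZdIdx d L → ℕ → OpsZd d 𝔸) (M : ℝ) (i : ZdIdx d L)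
    {a : Site d} {Mc ρ : ℕ} (hρ : L ≤ ρ) (hΩ : i.Ω = cubeFam false L a Mc ρ i.k) (hΛs : i.Λs = cubeLamS L a Mc ρ i.k) {m : ℕ} (hm : m ≤ i.k) :
    ∃ α : ℝ, 0 < α ∧ ∃ c : ℝ, 0 < c ∧ ∀ U₀ : Site d → Fin d → 𝔸ˣ, (∀ x κ, U₀ x κ ∈ unitaryUnits 𝔸) →
      pdevOn (fun i' => sqLo L a ρ i.k 0 i' - 3) (fun i' => sqHi L a Mc ρ i.k 0 i' + 3) U₀ < α →
        ∀ J : Site d → Fin d → 𝔸,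
          bondPair τ
              (gopZdH i.η (opsAllZd τ L (cubeLamBP L a Mc ρ i.k) ops₀ M i m) (i.Ω 0) U₀ J -
                gopZdH i.η (opsAllZd τ L (cubeLamBP L a Mc ρ i.k) ops₀ M i m) (i.Ω 0) 1 J)
              (gopZdH i.η (opsAllZd τ L (cubeLamBP L a Mc ρ i.k) ops₀ M i m) (i.Ω 0) U₀ J -
                gopZdH i.η (opsAllZd τ L (cubeLamBP L a Mc ρ i.k) ops₀ M i m) (i.Ω 0) 1 J) ≤
            c⁻¹ ^ 2 * bondPair τ
              (restrictLinH (𝔸 := 𝔸) (i.Ω 0)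
                (deltaAOf i.η (opsAllZd τ L (cubeLamBP L a Mc ρ i.k) ops₀ M i m) 1
                    (gopZdH i.η (opsAllZd τ L (cubeLamBP L a Mc ρ i.k) ops₀ M i m) (i.Ω 0) 1 J) -
                  deltaAOf i.η (opsAllZd τ L (cubeLamBP L a Mc ρ i.k) ops₀ M i m) U₀
                    (gopZdH i.η (opsAllZd τ L (cubeLamBP L a Mc ρ i.k) ops₀ M i m) (i.Ω 0) 1 J)) : Site d → Fin d → 𝔸)
              (restrictLinH (𝔸 := 𝔸) (i.Ω 0)
                (deltaAOf i.η (opsAllZd τ L (cubeLamBP L a Mc ρ i.k) ops₀ M i m) 1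
                    (gopZdH i.η (opsAllZd τ L (cubeLamBP L a Mc ρ i.k) ops₀ M i m) (i.Ω 0) 1 J) -
                  deltaAOf i.η (opsAllZd τ L (cubeLamBP L a Mc ρ i.k) ops₀ M i m) U₀
                    (gopZdH i.η (opsAllZd τ L (cubeLamBP L a Mc ρ i.k) ops₀ M i m) (i.Ω 0) 1 J)) : Site d → Fin d → 𝔸) := by
  obtain ⟨α, hα, c, hc, h⟩ := exists_resolventBound_of_pdevOn_lt_cube τ hτp hτt hτs hd2 hL ops₀ M i hρ hΩ hΛs hm
  have h1u : ∀ (x : Site d) (κ : Fin d), (1 : Site d → Fin d → 𝔸ˣ) x κ ∈ unitaryUnits 𝔸 := by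
    intro x κ
    show ((1 : 𝔸ˣ) : 𝔸) ∈ unitary 𝔸
    rw [Units.val_one]
    exact one_mem _
  have h1p : pdevOn (fun i' => sqLo L a ρ i.k 0 i' - 3) (fun i' => sqHi L a Mc ρ i.k 0 i' + 3) (1 : Site d → Fin d → 𝔸ˣ) < α := by
    rw [pdevOn_one]; exact hα
  exact ⟨α, hα, c, hc, fun U₀ hU₀ hsU J => (h U₀ 1 hU₀ h1u hsU h1p J).2⟩

end Cube

end Literature.MathematicalPhysics.QuantumFieldTheory.Balaban1983to89.B9Eq386ResolventBoundZd

end
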